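/-
Copyright (c) 2026 the pub-hodgecm-mathlib formalisation cell (harness21).  Prover seat hodgecm-mathlib-K2E4-p11 (g5), Track B ∕ K2-LIT, h413 =
`stmt-HodgeConjecture-24833`, line `K2_E1_TraceFormulaBeta`, campaign «EIS-RANK-ONE» ∕ R8-LADDER-2, «MS-2» — THE OPERATOR-ROAD PAYER, PART (O1)+(O3) (dealer K2E1-plan (g6)
ruling (66) 2026-09-04T10:23:08Z): the `L²(𝔛)`-holomorphic family `F z = [Λ^T Ẽ(z)]` of ★ socket p859344 `poleControl_continued_cm_two_of_family` from the Bernstein–Lapid vector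
solution `vX` through continuous linear maps, HYPOTHESIS-FIRST on the high-cusp operator `K_T` ((O2)) and the constant-term ∕ smoothing commutation (★-track (S-β)).
-/
import Summits.HodgeConjecture.HodgeConjecture.Theorems.K2E1BLHeckeOperatorHXU2Op        -- ★ `𝓗_k(𝔛)`, `w₁` facts (`supHeight_toAutomorphicQuotient`, `supHeight_pos`, `measurable_supHeight`, `bddAbove_…`), `ae_withDensity_weightX_iff`, `eLpNorm_two_withDensity_weightX`, T_X letters
import Summits.HodgeConjecture.HodgeConjecture.Theorems.K2E1TruncatedEisensteinL2          -- ★ `truncation_apply_eq_self_of_forall_borelHeight_le` (low region, any `φ`)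
import Literature.NumberTheory.Automorphic.UnitaryGroupTruncatedKernelHighCuspTwo         -- ★ `truncation_eq_self_sub_borelConstantTerm_of_rational_invariant_two` (high region, N = 2)
import Mathlib.Analysis.Calculus.FDeriv.Mul
import HarnessLib

/-!
# h413 ∕ Track B «K2-LIT», «MS-2» — `K2E1MaassSelbergFamilyPayerCMTwo`: THE OPERATOR ROAD (O1)+(O3) — `[Λ^T Ẽ(z)] = ĥ(z)⁻¹ • (A_T (T_X (vX z)) + K_T (vX z))` in `L²(𝔛, μ)`,
# hence `z ↦ [Λ^T Ẽ(z)]` is `L²`-HOLOMORPHIC wherever the Bernstein–Lapid vector `vX` is (continuous linear maps ∘ holomorphic), the input `F` of ★ socket p859344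

Cell `pub/hodgecm-mathlib`, crux H413 = `stmt-HodgeConjecture-24833`, route `HCCMUnconditional`; dealer K2E1-plan (g6) rulings (55)∕(66) («OPERATOR ROAD (O) «=» … GO (O1)+(O3) now, then
(O2)»).  THEOREMS ONLY (no `def` ∕ `instance` ∕ `notation` ∕ named-fact hypothesis ∕ `sorry`); lane `--kind proof --supports stmt-HodgeConjecture-24833 --as helper` (count-neutral;
closes no socket).
THE MATHEMATICS [BernsteinLapid2019, §4 p. 10; MoeglinWaldspurger1995, I.2.13, IV.2.3].  Off the Godement tube the continued spherical Eisenstein series of `U(1,1)` is, pointwise in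
`g`, `Ẽ(z)(g) = ĥ(z)⁻¹·∫ h(y)·ṽ_z(g y) dνG(y)` where `ṽ_z(g) = (vX z)[g⁻¹]` is the canonical lift of (a representative of) the Bernstein–Lapid vector `vX z ∈ 𝓗_k(𝔛) = L²(𝔛, w₁^{−2k}μ)`
(★ K2E1-p08 `exists_xSystem_byproducts` ∘ ★ P3-D `exists_bound_evalCLM_of_isCompact`).  Arthur's truncation in `F`-rank one splits along the cut-off `w₁(x) ≶ T` (`T ≥ 1`): on
`{w₁ ≤ T}` no `G(F)`-translate is above the cut-off and `Λ^T Ẽ = Ẽ` (★ `truncation_apply_eq_self_of_forall_borelHeight_le`), whose descent is `ĥ⁻¹·` the `𝔛`-side convolution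
`∫ h(y)·(vX z)(y⁻¹•x) dνG`, i.e. a.e. `ĥ⁻¹·T_X(vX z)` (★ `exists_shiftOperatorX`); on `{T < w₁}` a point is `x = [g⁻¹]` with `T < H(g)` and `Λ^T Ẽ(g) = Ẽ(g) − Ẽ_B(g)` (★ N = 2
`truncation_eq_self_sub_borelConstantTerm_of_rational_invariant_two`), and `Ẽ_B = ĥ⁻¹·∫ h(y)·ṽ_B(· y)` by the constant-term ∕ right-convolution commutation (letter `hcomm` = ★-track
(S-β) `borelConstantTerm_rightConv_comm`), so `Λ^T Ẽ(g) = ĥ⁻¹·∫ h(y)(ṽ − ṽ_B)(g y) dνG` — the transported high-cusp smoothing, which (O2) realises as a bounded operator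
`K_T : 𝓗_k(𝔛) →L L²(μ)` (★ K2 `hK1` decay + Siegel transport; here the letter `hK`).  With the low cut-off `A_T : 𝓗_k(𝔛) →L L²(μ)`, `u ↦ 𝟙_{w₁ ≤ T}·u` (§2, PROVED: on `{w₁ ≤ T}` the
weight `w₁^{−2k} ≥ T^{−2k}`, so `‖A_T u‖ ≤ T^k‖u‖`), the class of `Λ^T Ẽ(z)` in `L²(μ)` is `ĥ(z)⁻¹ • (A_T (T_X (vX z)) + K_T (vX z))`: continuous linear maps applied to the holomorphic
`vX`, times a holomorphic scalar — holomorphic, with no pointwise majorant and no identity principle for `L²`-valued maps (patches glue because `L²` classes that agree a.e. are equal, §1).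
* §1 `exists_differentiableOn_of_local_ae_eq` — GLUE (generic `Lp`): local holomorphic `L²`-valued representatives of one function family `f z` give a global one.
* §2 `exists_lowPart_clm` — (O1), rank-generic: the cut-off `A_T : 𝓗_k(𝔛) →L[ℂ] L²(μ)`, `A_T u =ᵐ 𝟙_{w₁ ≤ T}·u`, `‖A_T u‖ ≤ T^k·‖u‖`.
* §3 `quotFun_truncation_ae_eq_of_repr` — (O3), N = 2, functions only: `quotFun (Λ^T φ) =ᵐ[μ] a·(𝟙_{w₁ ≤ T}·Tu + Ku)` from the pointwise representation `φ = a·R(h)ũ`, the `T_X`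
  letter `Tu =ᵐ ∫ h(y) U(y⁻¹•·)`, the high-cusp letter `hKu`, `hcomm` and two integrability letters.
* §4 `exists_family_of_operator_letters` — ASSEMBLY: `∃ F : ℂ → L²(μ)`, holomorphic on `D`, `F z =ᵐ quotFun (Λ^T (Ec z))` on `D` — the `(hFd, hFtube)` input of ★ p859344 once
  `Ec z = E(φ₀H^z)` on the tube.
HONEST LABEL.  Count-neutral helper; proves no printed statement; (O2) (`hK`), `hcomm`, `hint₁`, `hint₂`, `hrepr` are LETTERS; HC_CM is proved only modulo the 7 printed citations (2 remaining
named inputs: hLiu418 = `stmt-HodgeConjecture-24832`, h413 = `stmt-HodgeConjecture-24833`) until rung 0 closes.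

## References
* [BernsteinLapid2019] J. Bernstein, E. Lapid, *On the meromorphic continuation of Eisenstein series*, J. AMS 37 (2024), §4 p. 10 (Claims 4–5).
* [MoeglinWaldspurger1995] C. Mœglin, J.-L. Waldspurger, *Spectral decomposition and Eisenstein series* (1995), I.2.13, IV.2.3, IV.3.12 (a).
* [Garrett2018] P. Garrett, *Modern analysis of automorphic forms by example* (2018), §2.10–§2.11.
-/

set_option autoImplicit false
set_option linter.dupNamespace false  -- the mandated namespace repeats the summit's segment (`HodgeConjecture.HodgeConjecture`)

noncomputable section

open MeasureTheory Measure NumberField IsDedekindDomain Set Filter Topology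
open scoped ENNReal NNReal
open Literature.NumberTheory.Automorphic Literature.NumberTheory.Automorphic.UnitaryGroup AdelicGroupData
open Summit.HodgeConjecture.HodgeConjecture.Cruxes.H413.K2E1BLBorelSpacesU2Defs
open Summit.HodgeConjecture.HodgeConjecture.Cruxes.H413.K2E1BLHeckeOperatorWeightedU2 (bddAbove_range_borelHeight_arith_mul)
open Summit.HodgeConjecture.HodgeConjecture.Cruxes.H413.K2E1BLHeckeOperatorHXU2 (supHeight_toAutomorphicQuotient supHeight_pos measurable_supHeight measurable_weightX)
open Summit.HodgeConjecture.HodgeConjecture.Cruxes.H413.K2E1BLHeckeOperatorHXU2Op (ae_withDensity_weightX_iff eLpNorm_two_withDensity_weightX)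
open Summit.HodgeConjecture.HodgeConjecture.Cruxes.H413.K2E1TruncatedEisensteinL2 (truncation_apply_eq_self_of_forall_borelHeight_le)

namespace Summit.HodgeConjecture.HodgeConjecture.Cruxes.H413.K2E1MaassSelbergFamilyPayerCMTwo

/-! ## §1 Glue: local holomorphic `L²`-valued representatives give a global one (no identity principle — `L²` classes agreeing a.e. are equal) -/

/-- **GLUE.**  If near every point of `D` the functions `f z` admit an `L²(μ)`-valued holomorphic representative (`G` holomorphic on a neighbourhood `V`, `G z =ᵐ f z` on `V ∩ D`), then
ONE map `F : ℂ → L²(μ)` is holomorphic on `D` with `F z =ᵐ f z` on `D`: take `F z :=` the class of `f z`; on `V ∩ D` it EQUALS `G z` (a.e.-equal classes coincide), so it is differentiable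
within `D` at the point. [cite: BernsteinLapid2019, §4 p. 10] -/
theorem exists_differentiableOn_of_local_ae_eq {α : Type} [MeasurableSpace α] {μ : Measure α} {D : Set ℂ} (f : ℂ → α → ℂ)
    (hloc : ∀ z₀ ∈ D, ∃ V ∈ 𝓝 z₀, ∃ G : ℂ → Lp ℂ 2 μ, DifferentiableOn ℂ G V ∧ ∀ z ∈ V ∩ D, ((G z : Lp ℂ 2 μ) : α → ℂ) =ᵐ[μ] f z) :
    ∃ F : ℂ → Lp ℂ 2 μ, DifferentiableOn ℂ F D ∧ ∀ z ∈ D, ((F z : Lp ℂ 2 μ) : α → ℂ) =ᵐ[μ] f z := by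
  classical
  have hmem : ∀ z ∈ D, MemLp (f z) 2 μ := by
    intro z hz
    obtain ⟨V, hV, G, -, hG⟩ := hloc z hz
    exact (Lp.memLp (G z)).ae_eq (hG z ⟨mem_of_mem_nhds hV, hz⟩)
  refine ⟨fun z => if h : MemLp (f z) 2 μ then h.toLp (f z) else 0, fun z₀ hz₀ => ?_, fun z hz => ?_⟩
  · obtain ⟨V, hV, G, hGd, hG⟩ := hloc z₀ hz₀
    have heq : ∀ z ∈ V ∩ D, (if h : MemLp (f z) 2 μ then h.toLp (f z) else 0) = G z := by
      intro z hz
      rw [dif_pos (hmem z hz.2)]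
      exact Lp.ext ((MemLp.coeFn_toLp _).trans (hG z hz).symm)
    have hGz : DifferentiableWithinAt ℂ G D z₀ := (hGd.differentiableAt hV).differentiableWithinAt
    refine hGz.congr_of_eventuallyEq ?_ (heq z₀ ⟨mem_of_mem_nhds hV, hz₀⟩)
    exact Set.EqOn.eventuallyEq_of_mem (fun z hz => heq z ⟨hz.2, hz.1⟩) (inter_mem_nhdsWithin D hV)
  · simp only [dif_pos (hmem z hz)]
    exact MemLp.coeFn_toLp _

/-- **GLUE, OPERATOR FORM**: if near every point of `D` there are a Banach-space-valued holomorphic `v`, a holomorphic scalar `a` and continuous linear maps `A, K` into `L²(μ)` with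
`f z =ᵐ a z • (A (v z) + K (v z))` on `V ∩ D`, then `f` has an `L²(μ)`-valued holomorphic representative on `D`. [cite: BernsteinLapid2019, §4 p. 10] -/
theorem exists_differentiableOn_of_local_operator_repr {α : Type} [MeasurableSpace α] {μ : Measure α} {H : Type} [NormedAddCommGroup H] [NormedSpace ℂ H] {D : Set ℂ}
    (f : ℂ → α → ℂ)
    (hloc : ∀ z₀ ∈ D, ∃ V ∈ 𝓝 z₀, ∃ (v : ℂ → H) (a : ℂ → ℂ) (A K : H →L[ℂ] Lp ℂ 2 μ), DifferentiableOn ℂ v V ∧ DifferentiableOn ℂ a V ∧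
      ∀ z ∈ V ∩ D, f z =ᵐ[μ] ((a z • (A (v z) + K (v z)) : Lp ℂ 2 μ) : α → ℂ)) :
    ∃ F : ℂ → Lp ℂ 2 μ, DifferentiableOn ℂ F D ∧ ∀ z ∈ D, ((F z : Lp ℂ 2 μ) : α → ℂ) =ᵐ[μ] f z := by
  refine exists_differentiableOn_of_local_ae_eq f fun z₀ hz₀ => ?_
  obtain ⟨V, hV, v, a, A, K, hv, ha, hf⟩ := hloc z₀ hz₀
  exact ⟨V, hV, fun z => a z • (A (v z) + K (v z)), ha.smul ((A + K).differentiable.comp_differentiableOn hv), fun z hz => (hf z hz).symm⟩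

/-! ## §2 (O1) The low cut-off `A_T : 𝓗_k(𝔛) →L[ℂ] L²(𝔛, μ)`, `u ↦ 𝟙_{w₁ ≤ T}·u` (rank `N`) -/

section LowPart

variable {F E : Type} [Field F] [NumberField F] [Field E] [NumberField E] [Algebra F E] {c : E ≃ₐ[F] E} {N : ℕ} [NeZero N]

/-- **(O1) THE LOW CUT-OFF OPERATOR.**  For every `k`, `T` and measure `μ` on `𝔛` there is a continuous linear `A_T : 𝓗_k(𝔛) = L²(𝔛, w₁^{−2k}μ) →L[ℂ] L²(𝔛, μ)` with
`A_T u =ᵐ[μ] 𝟙_{w₁ ≤ T}·u` and `‖A_T u‖ ≤ T^k·‖u‖`: on `{w₁ ≤ T}` one has `1 ≤ T^{2k}·w₁^{−2k}` (`w₁ > 0`, ★ `supHeight_pos`), so `∫ |𝟙u|² dμ ≤ T^{2k} ∫ w₁^{−2k}|u|² dμ`.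
[cite: BernsteinLapid2019, §4 p. 10] [cite: MoeglinWaldspurger1995, I.2.13] -/
theorem exists_lowPart_clm (k : ℕ) (T : ℝ≥0) (μ : Measure (quasiSplit F E c N).automorphicQuotient) :
    ∃ A : HX F E c N k μ →L[ℂ] Lp ℂ 2 μ,
      (∀ u : HX F E c N k μ, ((A u : Lp ℂ 2 μ) : (quasiSplit F E c N).automorphicQuotient → ℂ) =ᵐ[μ]
        {x | supHeight F E c N x ≤ T}.indicator (u : (quasiSplit F E c N).automorphicQuotient → ℂ)) ∧
      ∀ u : HX F E c N k μ, ‖A u‖ ≤ (T : ℝ) ^ k * ‖u‖ := by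
  set S : Set (quasiSplit F E c N).automorphicQuotient := {x | supHeight F E c N x ≤ T} with hSdef
  have hSm : MeasurableSet S := measurableSet_le measurable_supHeight measurable_const
  -- the weight comparison on `S`
  have hW : ∀ x ∈ S, (1 : ℝ≥0∞) ≤ (T : ℝ≥0∞) ^ (2 * k) * ((((supHeight F E c N x)⁻¹ ^ (2 * k) : ℝ≥0)) : ℝ≥0∞) := by
    intro x hx
    have h0 : 0 < supHeight F E c N x := supHeight_pos x
    have hxT : supHeight F E c N x ≤ T := hx
    have h1 : (1 : ℝ≥0) ≤ T * (supHeight F E c N x)⁻¹ := by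
      rw [← div_eq_mul_inv, one_le_div h0]; exact hxT
    have h2 : (1 : ℝ≥0) ≤ T ^ (2 * k) * (supHeight F E c N x)⁻¹ ^ (2 * k) := by rw [← mul_pow]; exact one_le_pow₀ h1
    have h3 : ((1 : ℝ≥0) : ℝ≥0∞) ≤ ((T ^ (2 * k) * (supHeight F E c N x)⁻¹ ^ (2 * k) : ℝ≥0) : ℝ≥0∞) := ENNReal.coe_le_coe.2 h2
    rw [ENNReal.coe_one, ENNReal.coe_mul, ENNReal.coe_pow] at h3
    exact h3
  -- square-integrability of the cut-off and the norm comparison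
  have hmem : ∀ u : HX F E c N k μ, MemLp (S.indicator (u : (quasiSplit F E c N).automorphicQuotient → ℂ)) 2 μ ∧
      eLpNorm (S.indicator (u : (quasiSplit F E c N).automorphicQuotient → ℂ)) 2 μ ≤
        (T : ℝ≥0∞) ^ k * eLpNorm (u : (quasiSplit F E c N).automorphicQuotient → ℂ) 2 (μ.withDensity fun x => (((supHeight F E c N x)⁻¹ ^ (2 * k) : ℝ≥0) : ℝ≥0∞)) := by
    intro u
    have hum : Measurable (u : (quasiSplit F E c N).automorphicQuotient → ℂ) := (Lp.stronglyMeasurable u).measurable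
    have hgm : Measurable (S.indicator (u : (quasiSplit F E c N).automorphicQuotient → ℂ)) := hum.indicator hSm
    have hTk : (T : ℝ≥0∞) ^ (2 * k) ≠ ∞ := ENNReal.pow_ne_top ENNReal.coe_ne_top
    have hle : ∫⁻ x, ‖S.indicator (u : (quasiSplit F E c N).automorphicQuotient → ℂ) x‖ₑ ^ 2 ∂μ ≤
        (T : ℝ≥0∞) ^ (2 * k) * ∫⁻ x, ((((supHeight F E c N x)⁻¹ ^ (2 * k) : ℝ≥0)) : ℝ≥0∞) * ‖(u : (quasiSplit F E c N).automorphicQuotient → ℂ) x‖ₑ ^ 2 ∂μ := by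
      rw [← lintegral_const_mul' _ _ hTk]
      refine lintegral_mono fun x => ?_
      by_cases hx : x ∈ S
      · rw [Set.indicator_of_mem hx, ← mul_assoc]
        calc ‖(u : (quasiSplit F E c N).automorphicQuotient → ℂ) x‖ₑ ^ 2 = 1 * ‖(u : (quasiSplit F E c N).automorphicQuotient → ℂ) x‖ₑ ^ 2 := (one_mul _).symm
          _ ≤ _ := mul_le_mul' (hW x hx) le_rfl
      · rw [Set.indicator_of_notMem hx, enorm_zero, zero_pow two_ne_zero]
        exact bot_le
    have heq : eLpNorm (S.indicator (u : (quasiSplit F E c N).automorphicQuotient → ℂ)) 2 μ =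
        (∫⁻ x, ‖S.indicator (u : (quasiSplit F E c N).automorphicQuotient → ℂ) x‖ₑ ^ 2 ∂μ) ^ (1 / 2 : ℝ) := by
      rw [eLpNorm_eq_lintegral_rpow_enorm_toReal two_ne_zero ENNReal.ofNat_ne_top, ENNReal.toReal_ofNat]
      congr 2
      funext x
      rw [show (2 : ℝ) = ((2 : ℕ) : ℝ) by norm_num, ENNReal.rpow_natCast]
    have hroot : ((T : ℝ≥0∞) ^ (2 * k)) ^ (1 / 2 : ℝ) = (T : ℝ≥0∞) ^ k := by
      rw [← ENNReal.rpow_natCast, ← ENNReal.rpow_mul, show ((2 * k : ℕ) : ℝ) * (1 / 2 : ℝ) = ((k : ℕ) : ℝ) by push_cast; ring, ENNReal.rpow_natCast]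
    have hbound : eLpNorm (S.indicator (u : (quasiSplit F E c N).automorphicQuotient → ℂ)) 2 μ ≤
        (T : ℝ≥0∞) ^ k * eLpNorm (u : (quasiSplit F E c N).automorphicQuotient → ℂ) 2 (μ.withDensity fun x => (((supHeight F E c N x)⁻¹ ^ (2 * k) : ℝ≥0) : ℝ≥0∞)) := by
      rw [heq, eLpNorm_two_withDensity_weightX μ k hum]
      calc (∫⁻ x, ‖S.indicator (u : (quasiSplit F E c N).automorphicQuotient → ℂ) x‖ₑ ^ 2 ∂μ) ^ (1 / 2 : ℝ)
          ≤ ((T : ℝ≥0∞) ^ (2 * k) * ∫⁻ x, ((((supHeight F E c N x)⁻¹ ^ (2 * k) : ℝ≥0)) : ℝ≥0∞) * ‖(u : (quasiSplit F E c N).automorphicQuotient → ℂ) x‖ₑ ^ 2 ∂μ) ^ (1 / 2 : ℝ) :=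
            ENNReal.rpow_le_rpow hle (by norm_num)
        _ = ((T : ℝ≥0∞) ^ (2 * k)) ^ (1 / 2 : ℝ) * (∫⁻ x, ((((supHeight F E c N x)⁻¹ ^ (2 * k) : ℝ≥0)) : ℝ≥0∞) * ‖(u : (quasiSplit F E c N).automorphicQuotient → ℂ) x‖ₑ ^ 2 ∂μ) ^ (1 / 2 : ℝ) :=
            ENNReal.mul_rpow_of_nonneg _ _ (by norm_num)
        _ = _ := by rw [hroot]
    exact ⟨⟨hgm.aestronglyMeasurable, lt_of_le_of_lt hbound (ENNReal.mul_lt_top (ENNReal.pow_ne_top ENNReal.coe_ne_top).lt_top (Lp.eLpNorm_lt_top u))⟩, hbound⟩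
  -- the linear map and its bound
  let Alin : HX F E c N k μ →ₗ[ℂ] Lp ℂ 2 μ :=
    { toFun := fun u => (hmem u).1.toLp _
      map_add' := fun u u' => by
        rw [← MemLp.toLp_add (hmem u).1 (hmem u').1]
        refine MemLp.toLp_congr _ _ ?_
        filter_upwards [(ae_withDensity_weightX_iff μ k).1 (Lp.coeFn_add u u')] with x hx
        simp only [Set.indicator_apply, Pi.add_apply, hx]
        split_ifs <;> simp
      map_smul' := fun a u => by
        rw [RingHom.id_apply, ← MemLp.toLp_const_smul a (hmem u).1]
        refine MemLp.toLp_congr _ _ ?_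
        filter_upwards [(ae_withDensity_weightX_iff μ k).1 (Lp.coeFn_smul a u)] with x hx
        simp only [Set.indicator_apply, Pi.smul_apply, hx, smul_eq_mul]
        split_ifs <;> simp }
  have hnorm : ∀ u : HX F E c N k μ, ‖Alin u‖ ≤ (T : ℝ) ^ k * ‖u‖ := by
    intro u
    change ‖(hmem u).1.toLp _‖ ≤ (T : ℝ) ^ k * ‖u‖
    rw [Lp.norm_toLp, Lp.norm_def]
    have hne : (T : ℝ≥0∞) ^ k * eLpNorm (u : (quasiSplit F E c N).automorphicQuotient → ℂ) 2 (μ.withDensity fun x => (((supHeight F E c N x)⁻¹ ^ (2 * k) : ℝ≥0) : ℝ≥0∞)) ≠ ∞ :=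
      ENNReal.mul_ne_top (ENNReal.pow_ne_top ENNReal.coe_ne_top) (Lp.eLpNorm_ne_top u)
    refine (ENNReal.toReal_mono hne (hmem u).2).trans_eq ?_
    rw [ENNReal.toReal_mul, ENNReal.toReal_pow, ENNReal.coe_toReal]
  refine ⟨Alin.mkContinuous ((T : ℝ) ^ k) hnorm, fun u => ?_, fun u => ?_⟩
  · rw [LinearMap.mkContinuous_apply]
    exact MemLp.coeFn_toLp (hmem u).1
  · rw [LinearMap.mkContinuous_apply]
    exact hnorm u

end LowPart

/-! ## §3 (O3) The a.e. identity `quotFun (Λ^T φ) = a·(𝟙_{w₁ ≤ T}·Tu + Ku)` on `𝔛` (`N = 2`; functions only) -/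

section Identity

variable {F E : Type} [Field F] [NumberField F] [Field E] [NumberField E] [Algebra F E] {c : E ≃ₐ[F] E}
variable [MeasurableSpace (quasiSplit F E c 2).Adelic] [BorelSpace (quasiSplit F E c 2).Adelic]

omit [MeasurableSpace (quasiSplit F E c 2).Adelic] [BorelSpace (quasiSplit F E c 2).Adelic] in
/-- A point of `𝔛` is the class of the inverse of `δ·x̃⁻¹` for every `δ ∈ G(F)` (`x̃ = out x`): `[(δ·x̃⁻¹)⁻¹] = [x̃·δ⁻¹] = [x̃] = x`. [cite: BernsteinLapid2019, §4 p. 10] -/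
theorem toAutomorphicQuotient_inv_arith_mul_out_inv (x : (quasiSplit F E c 2).automorphicQuotient) (δ : (quasiSplit F E c 2).arithmeticSubgroup) :
    (quasiSplit F E c 2).toAutomorphicQuotient
        ((δ : (quasiSplit F E c 2).Adelic) * (Quotient.out (x : (quasiSplit F E c 2).Adelic ⧸ (quasiSplit F E c 2).quotientSubgroup))⁻¹)⁻¹ = x := by
  have hx : (quasiSplit F E c 2).toAutomorphicQuotient (Quotient.out (x : (quasiSplit F E c 2).Adelic ⧸ (quasiSplit F E c 2).quotientSubgroup)) = x :=
    QuotientGroup.out_eq' _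
  conv_rhs => rw [← hx]
  rw [_root_.mul_inv_rev, inv_inv]
  change (QuotientGroup.mk _ : (quasiSplit F E c 2).Adelic ⧸ (quasiSplit F E c 2).quotientSubgroup) = QuotientGroup.mk _
  rw [QuotientGroup.eq, _root_.mul_inv_rev, inv_inv, mul_assoc, inv_mul_cancel, mul_one, quotientSubgroup_quasiSplit]
  exact δ.2

/-- **(O3) THE a.e. IDENTITY.**  `N = 2`, `ν` Haar with fundamental domain `𝓕`, `1 ≤ T`; `φ` left-`G(F)`-invariant (`= Ẽ(z)`) with the pointwise representation `φ g = a·∫ h(y)·ut(g y) dνG`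
through the canonical lift `ut g = U[g⁻¹]` of a function `U` on `𝔛` (`= vX z`, `a = ĥ(z)⁻¹`); `Tu =ᵐ ∫ h(y) U(y⁻¹•·) dνG` (the `T_X` letter of ★ `exists_shiftOperatorX`); `Ku` vanishes a.e.
on `{w₁ ≤ T}` and is the transported high-cusp smoothing `∫ h(y)(ut − ut_B)(g y) dνG` at a.e. `x = [g⁻¹]` with `T < H(g)` (the (O2) letter); `hcomm` = `(R(h)ut)_B(g) = ∫ h(y) ut_B(g y)`
above the cut-off (★-track (S-β)); integrability of `h·ut(g·)`, `h·ut_B(g·)` there.  THEN `quotFun (Λ^T φ) =ᵐ[μ] a·(𝟙_{w₁ ≤ T}·Tu + Ku)`.  LOW: `w₁(x) ≤ T` bounds every `H(δ x̃⁻¹)`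
(★ `supHeight_toAutomorphicQuotient`, `bddAbove_range_borelHeight_arith_mul`), so `Λ^T φ(x̃⁻¹) = φ(x̃⁻¹)` (★ low lemma) `= a·∫ h(y) U(y⁻¹•x)`; HIGH: `T < w₁(x)` produces `δ` with
`T < H(δ x̃⁻¹)`, `Λ^T φ` is `G(F)`-invariant (★ `truncation_rational_mul`) and `= φ − φ_B` there (★ N = 2 high lemma), `φ_B = a·∫ h(y) ut_B(· y)` (★ `borelConstantTerm_smul`, `hcomm`).
[cite: BernsteinLapid2019, §4 p. 10] [cite: MoeglinWaldspurger1995, I.2.13] [cite: Garrett2018, §2.10] -/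
theorem quotFun_truncation_ae_eq_of_repr (ν : Measure (adelicUnipotent F E c 2)) [ν.IsHaarMeasure] {𝓕 : Set (adelicUnipotent F E c 2)}
    (h𝓕 : IsFundamentalDomain (rationalUnipotent F E c 2) 𝓕 ν) {T : ℝ≥0} (hT : 1 ≤ T)
    (μ : Measure (quasiSplit F E c 2).automorphicQuotient) (νG : Measure (quasiSplit F E c 2).Adelic) (h : (quasiSplit F E c 2).Adelic → ℂ)
    {φ : (quasiSplit F E c 2).Adelic → ℂ} (hφ : ∀ γ : (quasiSplit F E c 2).arithmeticSubgroup, ∀ x : (quasiSplit F E c 2).Adelic, φ ((γ : (quasiSplit F E c 2).Adelic) * x) = φ x)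
    (U : (quasiSplit F E c 2).automorphicQuotient → ℂ) {ut : (quasiSplit F E c 2).Adelic → ℂ} (hut : ∀ g, ut g = U ((quasiSplit F E c 2).toAutomorphicQuotient g⁻¹)) (a : ℂ)
    (hrepr : ∀ g, φ g = a * ∫ y, h y * ut (g * y) ∂νG)
    {Tu : (quasiSplit F E c 2).automorphicQuotient → ℂ} (hTu : Tu =ᵐ[μ] fun ξ => ∫ y, h y * U (y⁻¹ • ξ) ∂νG)
    {Ku : (quasiSplit F E c 2).automorphicQuotient → ℂ}
    (hKu : ∀ᵐ x ∂μ, (supHeight F E c 2 x ≤ T → Ku x = 0) ∧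
      ∀ g : (quasiSplit F E c 2).Adelic, (quasiSplit F E c 2).toAutomorphicQuotient g⁻¹ = x → T < borelHeight g →
        Ku x = ∫ y, h y * (ut (g * y) - borelConstantTerm ν 𝓕 ut (g * y)) ∂νG)
    (hcomm : ∀ g : (quasiSplit F E c 2).Adelic, T < borelHeight g →
      borelConstantTerm ν 𝓕 (fun x => ∫ y, h y * ut (x * y) ∂νG) g = ∫ y, h y * borelConstantTerm ν 𝓕 ut (g * y) ∂νG)
    (hint₁ : ∀ g : (quasiSplit F E c 2).Adelic, T < borelHeight g → Integrable (fun y => h y * ut (g * y)) νG)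
    (hint₂ : ∀ g : (quasiSplit F E c 2).Adelic, T < borelHeight g → Integrable (fun y => h y * borelConstantTerm ν 𝓕 ut (g * y)) νG) :
    (quasiSplit F E c 2).quotFun (truncation ν 𝓕 T φ) =ᵐ[μ] fun x => a * ({x | supHeight F E c 2 x ≤ T}.indicator Tu x + Ku x) := by
  filter_upwards [hTu, hKu] with x hxT hxK
  -- the representative `x̃` and the height supremum at `x`
  set xo : (quasiSplit F E c 2).Adelic := Quotient.out (x : (quasiSplit F E c 2).Adelic ⧸ (quasiSplit F E c 2).quotientSubgroup) with hxodef
  have hx : (quasiSplit F E c 2).toAutomorphicQuotient xo = x := QuotientGroup.out_eq' _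
  have hsup : supHeight F E c 2 x = ⨆ γ : (quasiSplit F E c 2).arithmeticSubgroup, borelHeight ((γ : (quasiSplit F E c 2).Adelic) * xo⁻¹) := by
    conv_lhs => rw [← hx]
    exact supHeight_toAutomorphicQuotient xo
  have hq : (quasiSplit F E c 2).quotFun (truncation ν 𝓕 T φ) x = truncation ν 𝓕 T φ xo⁻¹ := rfl
  by_cases hle : supHeight F E c 2 x ≤ T
  · -- LOW: no translate above the cut-off
    have hall : ∀ δ : (quasiSplit F E c 2).arithmeticSubgroup, borelHeight ((δ : (quasiSplit F E c 2).Adelic) * xo⁻¹) ≤ T := fun δ =>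
      (le_ciSup (bddAbove_range_borelHeight_arith_mul xo⁻¹) δ).trans (hsup ▸ hle)
    rw [hq, truncation_apply_eq_self_of_forall_borelHeight_le ν 𝓕 φ hall, hrepr, Set.indicator_of_mem (show x ∈ {x | supHeight F E c 2 x ≤ T} from hle), (hxK.1 hle), add_zero, hxT]
    congr 1
    refine integral_congr_ae (Eventually.of_forall fun y => ?_)
    show h y * ut (xo⁻¹ * y) = h y * U (y⁻¹ • x)
    rw [hut, _root_.mul_inv_rev, inv_inv]
    congr 2
    rw [← hx]
    rfl
  · -- HIGH: `x = [g⁻¹]` with `T < H(g)`, `Λ^T φ(g) = φ(g) − φ_B(g)`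
    have hlt : T < supHeight F E c 2 x := not_le.1 hle
    rw [hsup] at hlt
    obtain ⟨δ, hδ⟩ := exists_lt_of_lt_ciSup hlt
    set g : (quasiSplit F E c 2).Adelic := (δ : (quasiSplit F E c 2).Adelic) * xo⁻¹ with hgdef
    have hgx : (quasiSplit F E c 2).toAutomorphicQuotient g⁻¹ = x := toAutomorphicQuotient_inv_arith_mul_out_inv x δ
    have hinv : truncation ν 𝓕 T φ xo⁻¹ = truncation ν 𝓕 T φ g := by
      have h1 : xo⁻¹ = ((δ⁻¹ : (quasiSplit F E c 2).arithmeticSubgroup) : (quasiSplit F E c 2).Adelic) * g := by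
        rw [hgdef, Subgroup.coe_inv, inv_mul_cancel_left]
      rw [h1, truncation_rational_mul ν h𝓕 T hφ]
    have hφfun : φ = a • fun x => ∫ y, h y * ut (x * y) ∂νG := by
      funext g'; rw [Pi.smul_apply, smul_eq_mul]; exact hrepr g'
    have hB : borelConstantTerm ν 𝓕 φ g = a * ∫ y, h y * borelConstantTerm ν 𝓕 ut (g * y) ∂νG := by
      rw [hφfun, borelConstantTerm_smul, hcomm g hδ]
    rw [hq, hinv, truncation_eq_self_sub_borelConstantTerm_of_rational_invariant_two ν h𝓕 hφ hT hδ, hB, hrepr g,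
      Set.indicator_of_notMem (show x ∉ {x | supHeight F E c 2 x ≤ T} from hle), zero_add, hxK.2 g hgx hδ, ← mul_sub,
      ← integral_sub (hint₁ g hδ) (hint₂ g hδ)]
    congr 1
    refine integral_congr_ae (Eventually.of_forall fun y => ?_)
    show h y * ut (g * y) - h y * borelConstantTerm ν 𝓕 ut (g * y) = h y * (ut (g * y) - borelConstantTerm ν 𝓕 ut (g * y))
    ring

end Identity

/-! ## §4 Assembly: the `L²(μ)`-holomorphic family `F z = ĥ(z)⁻¹ • (A_T (T_X (vX z)) + K_T (vX z))`, `F z =ᵐ quotFun (Λ^T (Ec z))` -/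

section Assembly

variable {F E : Type} [Field F] [NumberField F] [Field E] [NumberField E] [Algebra F E] {c : E ≃ₐ[F] E}
variable [MeasurableSpace (quasiSplit F E c 2).Adelic] [BorelSpace (quasiSplit F E c 2).Adelic]

/-- **ASSEMBLY: THE OPERATOR ROAD.**  `N = 2`; `ν` Haar with fundamental domain `𝓕`, `1 ≤ T`; `D ⊆ ℂ` (any set); `vX : ℂ → 𝓗_k(𝔛)` holomorphic on `D` (★ `exists_xSystem_byproducts`); `ĥ` holomorphic and
non-vanishing on `D`; the continued functions `Ec z` left-`G(F)`-invariant with the pointwise representation `Ec z g = ĥ(z)⁻¹·∫ h(y)·(vX z)[(g y)⁻¹] dνG` on `D`; the `𝔛`-side smoothing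
operator `T_X` with its a.e. formula (★ `exists_shiftOperatorX`); the low cut-off `A_T` (§2 `exists_lowPart_clm`); the high-cusp operator `K_T : 𝓗_k(𝔛) →L L²(μ)` with its a.e. description
`hK` ((O2)); and, for `z ∈ D` above the cut-off, the commutation `hcomm` (★-track (S-β)) and two integrabilities.  THEN `F z := ĥ(z)⁻¹ • (A_T (T_X (vX z)) + K_T (vX z))` is holomorphic on
`D` and `F z =ᵐ[μ] quotFun (Λ^T (Ec z))` for `z ∈ D` — the input `(hFd, hFtube)` of ★ `poleControl_continued_cm_two_of_family` as soon as `Ec z = E(φ₀H^z)` on the tube.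
[cite: BernsteinLapid2019, §4 p. 10] [cite: MoeglinWaldspurger1995, IV.2.3] -/
theorem exists_family_of_operator_letters (ν : Measure (adelicUnipotent F E c 2)) [ν.IsHaarMeasure] {𝓕 : Set (adelicUnipotent F E c 2)}
    (h𝓕 : IsFundamentalDomain (rationalUnipotent F E c 2) 𝓕 ν) {T : ℝ≥0} (hT : 1 ≤ T) (k : ℕ)
    (μ : Measure (quasiSplit F E c 2).automorphicQuotient) (νG : Measure (quasiSplit F E c 2).Adelic) (h : (quasiSplit F E c 2).Adelic → ℂ)
    {D : Set ℂ} (vX : ℂ → HX F E c 2 k μ) (hvX : DifferentiableOn ℂ vX D)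
    (ĥ : ℂ → ℂ) (hĥ : DifferentiableOn ℂ ĥ D) (hĥ0 : ∀ z ∈ D, ĥ z ≠ 0)
    (Ec : ℂ → (quasiSplit F E c 2).Adelic → ℂ)
    (hEcinv : ∀ z ∈ D, ∀ γ : (quasiSplit F E c 2).arithmeticSubgroup, ∀ x : (quasiSplit F E c 2).Adelic, Ec z ((γ : (quasiSplit F E c 2).Adelic) * x) = Ec z x)
    (hrepr : ∀ z ∈ D, ∀ g : (quasiSplit F E c 2).Adelic,
      Ec z g = (ĥ z)⁻¹ * ∫ y, h y * ((vX z : HX F E c 2 k μ) : (quasiSplit F E c 2).automorphicQuotient → ℂ) ((quasiSplit F E c 2).toAutomorphicQuotient (g * y)⁻¹) ∂νG)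
    (TX : HX F E c 2 k μ →L[ℂ] HX F E c 2 k μ)
    (hTX : ∀ u : HX F E c 2 k μ, ((TX u : HX F E c 2 k μ) : (quasiSplit F E c 2).automorphicQuotient → ℂ)
      =ᵐ[μ.withDensity fun x => (((supHeight F E c 2 x)⁻¹ ^ (2 * k) : ℝ≥0) : ℝ≥0∞)]
        fun ξ => ∫ y, h y * (u : (quasiSplit F E c 2).automorphicQuotient → ℂ) (y⁻¹ • ξ) ∂νG)
    (A : HX F E c 2 k μ →L[ℂ] Lp ℂ 2 μ)
    (hA : ∀ u : HX F E c 2 k μ, ((A u : Lp ℂ 2 μ) : (quasiSplit F E c 2).automorphicQuotient → ℂ) =ᵐ[μ]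
      {x | supHeight F E c 2 x ≤ T}.indicator (u : (quasiSplit F E c 2).automorphicQuotient → ℂ))
    (K : HX F E c 2 k μ →L[ℂ] Lp ℂ 2 μ)
    (hK : ∀ u : HX F E c 2 k μ, ∀ᵐ x ∂μ, (supHeight F E c 2 x ≤ T → ((K u : Lp ℂ 2 μ) : (quasiSplit F E c 2).automorphicQuotient → ℂ) x = 0) ∧
      ∀ g : (quasiSplit F E c 2).Adelic, (quasiSplit F E c 2).toAutomorphicQuotient g⁻¹ = x → T < borelHeight g →
        ((K u : Lp ℂ 2 μ) : (quasiSplit F E c 2).automorphicQuotient → ℂ) x =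
          ∫ y, h y * ((u : (quasiSplit F E c 2).automorphicQuotient → ℂ) ((quasiSplit F E c 2).toAutomorphicQuotient (g * y)⁻¹) -
            borelConstantTerm ν 𝓕 (fun g' => (u : (quasiSplit F E c 2).automorphicQuotient → ℂ) ((quasiSplit F E c 2).toAutomorphicQuotient g'⁻¹)) (g * y)) ∂νG)
    (hcomm : ∀ z ∈ D, ∀ g : (quasiSplit F E c 2).Adelic, T < borelHeight g →
      borelConstantTerm ν 𝓕 (fun x => ∫ y, h y * ((vX z : HX F E c 2 k μ) : (quasiSplit F E c 2).automorphicQuotient → ℂ) ((quasiSplit F E c 2).toAutomorphicQuotient (x * y)⁻¹) ∂νG) g =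
        ∫ y, h y * borelConstantTerm ν 𝓕 (fun g' => ((vX z : HX F E c 2 k μ) : (quasiSplit F E c 2).automorphicQuotient → ℂ) ((quasiSplit F E c 2).toAutomorphicQuotient g'⁻¹)) (g * y) ∂νG)
    (hint₁ : ∀ z ∈ D, ∀ g : (quasiSplit F E c 2).Adelic, T < borelHeight g →
      Integrable (fun y => h y * ((vX z : HX F E c 2 k μ) : (quasiSplit F E c 2).automorphicQuotient → ℂ) ((quasiSplit F E c 2).toAutomorphicQuotient (g * y)⁻¹)) νG)
    (hint₂ : ∀ z ∈ D, ∀ g : (quasiSplit F E c 2).Adelic, T < borelHeight g →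
      Integrable (fun y => h y * borelConstantTerm ν 𝓕 (fun g' => ((vX z : HX F E c 2 k μ) : (quasiSplit F E c 2).automorphicQuotient → ℂ) ((quasiSplit F E c 2).toAutomorphicQuotient g'⁻¹)) (g * y)) νG) :
    ∃ Fam : ℂ → Lp ℂ 2 μ, DifferentiableOn ℂ Fam D ∧
      ∀ z ∈ D, ((Fam z : Lp ℂ 2 μ) : (quasiSplit F E c 2).automorphicQuotient → ℂ) =ᵐ[μ] (quasiSplit F E c 2).quotFun (truncation ν 𝓕 T (Ec z)) := by
  refine ⟨fun z => (ĥ z)⁻¹ • ((A.comp TX + K) (vX z)), (hĥ.inv hĥ0).smul ((A.comp TX + K).differentiable.comp_differentiableOn hvX), fun z hz => ?_⟩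
  -- §3 at `z`, with `U := vX z`, `ut` its canonical lift, `a := ĥ(z)⁻¹`, `Tu := T_X (vX z)`, `Ku := K_T (vX z)`
  have h3 := quotFun_truncation_ae_eq_of_repr ν h𝓕 hT μ νG h (hEcinv z hz) ((vX z : HX F E c 2 k μ) : (quasiSplit F E c 2).automorphicQuotient → ℂ)
    (ut := fun g => ((vX z : HX F E c 2 k μ) : (quasiSplit F E c 2).automorphicQuotient → ℂ) ((quasiSplit F E c 2).toAutomorphicQuotient g⁻¹)) (fun _ => rfl) (ĥ z)⁻¹
    (hrepr z hz) ((ae_withDensity_weightX_iff μ k).1 (hTX (vX z))) (hK (vX z)) (hcomm z hz) (hint₁ z hz) (hint₂ z hz)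
  have hsm := Lp.coeFn_smul (ĥ z)⁻¹ ((A.comp TX + K) (vX z))
  have hadd := Lp.coeFn_add (A (TX (vX z))) (K (vX z))
  filter_upwards [h3, hsm, hadd, hA (TX (vX z))] with x hx hxs hxa hxA
  rw [hx, hxs, Pi.smul_apply, smul_eq_mul, FunLike.coe_add, Pi.add_apply, ContinuousLinearMap.comp_apply, hxa, Pi.add_apply, hxA]

end Assembly

end Summit.HodgeConjecture.HodgeConjecture.Cruxes.H413.K2E1MaassSelbergFamilyPayerCMTwo

end
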